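import Summits.NavierStokesRegularity.NavierStokesRegularity.Theorems.SelfMixingDichotomyMixingPayoffAdvectionDiffusionSeeley
import Mathlib.Analysis.InnerProductSpace.PiL2
import HarnessLib

/-!
# Crux `MixingPayoff` (stmt-NavierStokesRegularity-1422), line `birth`, stub W2
  (`stub_advectionDiffusionSchwartz`): `C_b^∞` extension of slab-smooth fields with bounded
  derivatives

Helper file (lands `--supports stmt-NavierStokesRegularity-1422`). A field `v : ℝ → E → W`
which is jointly `C^∞` on a closed time slab `[a, b] × E` in the within sense, with every
space–time derivative (within the slab) bounded, extends to a field on `ℝ × E` which is `C^∞`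
with EVERY derivative bounded and agrees with `v` on `[a, b]` (`exists_cb_extension`). The
extension is the tree's `Literature.Analysis.PDE.slabExtend` (Seeley's operator at both ends,
glued with the weight `ψ₁(t/T)`; `TimeExtension.lean`, whose `contDiff_uncurry_slabExtend` is
the smoothness) translated in time; the bounds come from `seeley_extend_bound`
(`…AdvectionDiffusionSeeley`), the bounded derivatives of the glue weight, Leibniz, and the
behaviour of within-slab derivatives under the affine maps `t ↦ a + t`, `t ↦ T − t`
(`norm_iteratedFDerivWithin_comp_affine_le`).
-/

noncomputable section

open Set Function Filter Topology
open scoped ContDiff Topology Pointwise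

-- `Summit = Problem` for this summit; the tree lakefile sets `weak.linter.dupNamespace = false`.
set_option linter.dupNamespace false

namespace Summit.NavierStokesRegularity.NavierStokesRegularity.Theorems.SelfMixingDichotomy.MixingPayoffBirth

open Literature.Analysis.Calculus Literature.Analysis.Calculus.Seeley Literature.Analysis.PDE

variable {E : Type*} [NormedAddCommGroup E] [NormedSpace ℝ E]
variable {W : Type*} [NormedAddCommGroup W] [NormedSpace ℝ W]

/-! ### Within-slab derivatives under affine reparametrisations -/

/-- **Within derivatives under an affine change of variables** `q ↦ c + L q` (`L` a continuous
linear equivalence): `‖Dʲ (f ∘ A)‖` within `L⁻¹' S₁` at `p` is at most `‖Dʲ f‖` within `c + S₁`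
at `A p`, times `‖L‖ʲ`. -/
theorem norm_iteratedFDerivWithin_comp_affine_le {f : ℝ × E → W} (L : (ℝ × E) ≃L[ℝ] (ℝ × E))
    (c : ℝ × E) {S₁ : Set (ℝ × E)} (hS₁ : UniqueDiffOn ℝ S₁) {p : ℝ × E} (hp : L p ∈ S₁) (j : ℕ) :
    ‖iteratedFDerivWithin ℝ j (fun q => f (c + L q)) (L ⁻¹' S₁) p‖ ≤
      ‖iteratedFDerivWithin ℝ j f (c +ᵥ S₁) (c + L p)‖ * ‖(L : (ℝ × E) →L[ℝ] (ℝ × E))‖ ^ j := by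
  rw [show (fun q => f (c + L q)) = (fun z => f (c + z)) ∘ ⇑L from rfl,
    L.iteratedFDerivWithin_comp_right _ hS₁ hp j, iteratedFDerivWithin_comp_add_left]
  refine (ContinuousMultilinearMap.norm_compContinuousLinearMap_le _ _).trans ?_
  rw [Finset.prod_const, Finset.card_univ, Fintype.card_fin]

/-- The time reflection `(t, x) ↦ (-t, x)` as a continuous linear equivalence. -/
theorem reflect_apply (p : ℝ × E) :
    ((ContinuousLinearEquiv.neg ℝ).prodCongr (ContinuousLinearEquiv.refl ℝ E)) p = (-p.1, p.2) := by
  simp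

/-- **Within-slab bounds for the reflected field** `Φʳ(s, y) = Φ(T − s, y)`. -/
theorem within_bounds_reflect {Φ : ℝ → E → W} {T : ℝ} (hT : 0 < T)
    (hb : ∀ j, ∃ C, ∀ p ∈ Icc 0 T ×ˢ (univ : Set E),
      ‖iteratedFDerivWithin ℝ j (uncurry Φ) (Icc 0 T ×ˢ univ) p‖ ≤ C) (j : ℕ) :
    ∃ C, ∀ p ∈ Icc 0 T ×ˢ (univ : Set E),
      ‖iteratedFDerivWithin ℝ j (uncurry fun s y => Φ (T - s) y) (Icc 0 T ×ˢ univ) p‖ ≤ C := by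
  set L : (ℝ × E) ≃L[ℝ] (ℝ × E) :=
    (ContinuousLinearEquiv.neg ℝ).prodCongr (ContinuousLinearEquiv.refl ℝ E) with hL
  set c : ℝ × E := (T, 0) with hc
  set S₁ : Set (ℝ × E) := Icc (-T) 0 ×ˢ univ with hS₁
  have hS₁U : UniqueDiffOn ℝ S₁ := (uniqueDiffOn_Icc (by linarith)).prod uniqueDiffOn_univ
  have hpre : L ⁻¹' S₁ = Icc 0 T ×ˢ univ := by
    ext q
    simp only [hS₁, mem_preimage, hL, ContinuousLinearEquiv.prodCongr_apply,
      ContinuousLinearEquiv.neg_apply, ContinuousLinearEquiv.refl_apply, mem_prod, mem_Icc, mem_univ,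
      and_true]
    constructor <;> intro h <;> constructor <;> linarith [h.1, h.2]
  have hvadd : c +ᵥ S₁ = Icc 0 T ×ˢ univ := by
    ext q
    rw [Set.mem_vadd_set_iff_neg_vadd_mem]
    simp only [hS₁, hc, mem_prod, mem_Icc, mem_univ, and_true, Prod.neg_mk, neg_zero,
      vadd_eq_add, zero_add, Prod.fst_add, Prod.snd_add]
    constructor <;> intro h <;> constructor <;> linarith [h.1, h.2]
  have hfun : (uncurry fun s y => Φ (T - s) y) = fun q => uncurry Φ (c + L q) := by
    funext q
    simp [hc, hL, uncurry, sub_eq_add_neg]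
  obtain ⟨C, hC⟩ := hb j
  refine ⟨C * ‖(L : (ℝ × E) →L[ℝ] (ℝ × E))‖ ^ j, fun p hp => ?_⟩
  have hpL : L p ∈ S₁ := by rw [← mem_preimage, hpre]; exact hp
  have h := norm_iteratedFDerivWithin_comp_affine_le (f := uncurry Φ) L c hS₁U hpL j
  rw [hpre, hvadd] at h
  rw [hfun]
  refine h.trans (mul_le_mul_of_nonneg_right (hC _ ?_) (by positivity))
  rw [← hvadd]
  exact Set.vadd_mem_vadd_set hpL

/-! ### The glue weight -/

/-- The glue weight through Seeley's cutoff: `ψ₁(s) = φ(−3s/4)`. -/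
theorem glueWeight_eq_cutoff (s : ℝ) : glueWeight s = Seeley.cutoff (-(3 / 4) * s) := by
  simp only [glueWeight, Seeley.cutoff]
  ring_nf

/-- **All derivatives of the glue weight `(t, x) ↦ ψ₁(t/T)` are bounded.** -/
theorem norm_iteratedFDeriv_glue_le (T : ℝ) (i : ℕ) :
    ∃ C, ∀ p : ℝ × E, ‖iteratedFDeriv ℝ i (fun p : ℝ × E => glueWeight (p.1 / T)) p‖ ≤ C := by
  set Lw : (ℝ × E) →L[ℝ] ℝ := (-(3 / 4) / T) • ContinuousLinearMap.fst ℝ ℝ E with hLw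
  have hfun : (fun p : ℝ × E => glueWeight (p.1 / T)) = Seeley.cutoff ∘ Lw := by
    funext p
    simp only [comp_apply, hLw, FunLike.coe_smul, Pi.smul_apply,
      ContinuousLinearMap.coe_fst', smul_eq_mul, glueWeight_eq_cutoff]
    ring_nf
  refine ⟨Seeley.cutoffBound i * ‖Lw‖ ^ i, fun p => ?_⟩
  rw [hfun, Lw.iteratedFDeriv_comp_right Seeley.contDiff_cutoff p (mod_cast le_top)]
  refine (ContinuousMultilinearMap.norm_compContinuousLinearMap_le _ _).trans ?_
  rw [Finset.prod_const, Finset.card_univ, Fintype.card_fin]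
  exact mul_le_mul_of_nonneg_right (Seeley.norm_iteratedFDeriv_cutoff_le i _) (by positivity)

/-- All derivatives of `1 − ψ₁(t/T)` are bounded. -/
theorem norm_iteratedFDeriv_one_sub_glue_le (T : ℝ) (i : ℕ) :
    ∃ C, ∀ p : ℝ × E, ‖iteratedFDeriv ℝ i (fun p : ℝ × E => 1 - glueWeight (p.1 / T)) p‖ ≤ C := by
  obtain ⟨C, hC⟩ := norm_iteratedFDeriv_glue_le (E := E) T i
  have hw : ContDiff ℝ ∞ fun p : ℝ × E => glueWeight (p.1 / T) :=
    contDiff_glueWeight.comp (contDiff_fst.div_const T)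
  refine ⟨1 + C, fun p => ?_⟩
  rw [show (fun p : ℝ × E => 1 - glueWeight (p.1 / T)) =
      (fun _ => (1 : ℝ)) - fun p : ℝ × E => glueWeight (p.1 / T) from rfl,
    iteratedFDeriv_sub_apply (contDiff_const.contDiffAt.of_le (mod_cast le_top))
      (hw.contDiffAt.of_le (mod_cast le_top))]
  refine (norm_sub_le _ _).trans (add_le_add ?_ (hC p))
  rcases i with _ | i
  · simp
  · rw [iteratedFDeriv_const_of_ne (by omega)]; simp

/-! ### The slab extension -/

/-- **Leibniz on an open set with uniform bounds**: if `w` is globally smooth with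
`‖Dⁱ w‖ ≤ Cw` for `i ≤ n`, and `g` is smooth on the open set `U` with `‖Dⁱ g‖ ≤ Cg` on `U`
for `i ≤ n`, then `‖Dⁿ (w • g)‖ ≤ 2ⁿ Cw Cg` on `U`. -/
theorem norm_iteratedFDeriv_smul_le_of_open {w : ℝ × E → ℝ} {g : ℝ × E → W} {U : Set (ℝ × E)}
    (hU : IsOpen U) (hw : ContDiff ℝ ∞ w) (hg : ContDiffOn ℝ ∞ g U) {n : ℕ} {Cw Cg : ℝ}
    (hCw : ∀ i ≤ n, ∀ p, ‖iteratedFDeriv ℝ i w p‖ ≤ Cw)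
    (hCg : ∀ i ≤ n, ∀ p ∈ U, ‖iteratedFDeriv ℝ i g p‖ ≤ Cg) {p : ℝ × E} (hp : p ∈ U) :
    ‖iteratedFDeriv ℝ n (fun q => w q • g q) p‖ ≤ 2 ^ n * Cw * Cg := by
  have hCw0 : 0 ≤ Cw := (norm_nonneg _).trans (hCw 0 (Nat.zero_le _) p)
  have hCg0 : 0 ≤ Cg := (norm_nonneg _).trans (hCg 0 (Nat.zero_le _) p hp)
  rw [← iteratedFDerivWithin_of_isOpen n hU hp]
  have h := norm_iteratedFDerivWithin_smul_le (hw.contDiffOn (s := U)) hg hU.uniqueDiffOn hp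
    (n := n) (mod_cast le_top)
  refine h.trans ?_
  have hsum : ∑ i ∈ Finset.range (n + 1), (n.choose i : ℝ) * ‖iteratedFDerivWithin ℝ i w U p‖ *
      ‖iteratedFDerivWithin ℝ (n - i) g U p‖ ≤ ∑ i ∈ Finset.range (n + 1), (n.choose i : ℝ) * (Cw * Cg) := by
    refine Finset.sum_le_sum fun i hi => ?_
    have hin : i ≤ n := Nat.lt_succ_iff.1 (Finset.mem_range.1 hi)
    rw [mul_assoc, iteratedFDerivWithin_of_isOpen i hU hp, iteratedFDerivWithin_of_isOpen (n - i) hU hp]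
    refine mul_le_mul_of_nonneg_left ?_ (by positivity)
    exact mul_le_mul (hCw i hin p) (hCg (n - i) (Nat.sub_le n i) p hp) (norm_nonneg _) hCw0
  refine hsum.trans ?_
  rw [← Finset.sum_mul]
  have := Nat.sum_range_choose n
  have h2 : ∑ i ∈ Finset.range (n + 1), (n.choose i : ℝ) = 2 ^ n := by exact_mod_cast this
  rw [h2]; ring_nf; rfl

/-- Derivatives of a function vanishing on an open set vanish there. -/
theorem iteratedFDeriv_eq_zero_of_eqOn {F : ℝ × E → W} {V : Set (ℝ × E)} (hV : IsOpen V)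
    (hF : ∀ q ∈ V, F q = 0) {p : ℝ × E} (hp : p ∈ V) (n : ℕ) : iteratedFDeriv ℝ n F p = 0 := by
  have hev : F =ᶠ[𝓝 p] fun _ => (0 : W) := by
    filter_upwards [hV.mem_nhds hp] with q hq using hF q hq
  rw [(hev.iteratedFDeriv ℝ n).eq_of_nhds, iteratedFDeriv_fun_zero, Pi.zero_apply]

set_option maxHeartbeats 1600000 in
/-- **Global derivative bounds for the slab extension.** If `uncurry Φ` is `C^∞` on
`[0, T] × E` (within, `T > 0`) with all within-slab derivatives bounded, then every derivative
of `uncurry (slabExtend T Φ)` is bounded on `ℝ × E`. -/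
theorem slabExtend_bound [CompleteSpace W] {Φ : ℝ → E → W} {T : ℝ} (hT : 0 < T)
    (hΦ : ContDiffOn ℝ ∞ (uncurry Φ) (Icc 0 T ×ˢ univ))
    (hb : ∀ j, ∃ C, ∀ p ∈ Icc 0 T ×ˢ (univ : Set E),
      ‖iteratedFDerivWithin ℝ j (uncurry Φ) (Icc 0 T ×ˢ univ) p‖ ≤ C) (n : ℕ) :
    ∃ C, ∀ p : ℝ × E, ‖iteratedFDeriv ℝ n (uncurry (slabExtend T Φ)) p‖ ≤ C := by
  -- the two Seeley extensions and their bounds below `t = T`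
  have hslab : Seeley.slab T (univ : Set E) ⊆ Icc 0 T ×ˢ univ := prod_mono Ico_subset_Icc_self le_rfl
  have hΦr : ContDiffOn ℝ ∞ (uncurry fun s y => Φ (T - s) y) (Icc 0 T ×ˢ univ) :=
    contDiffOn_uncurry_reflect hΦ
  have hbr := within_bounds_reflect hT hb
  set ext₁ : ℝ × E → W := Seeley.extend T (uncurry Φ) with hext₁
  set ext₂ : ℝ × E → W := Seeley.extend T (uncurry fun s y => Φ (T - s) y) with hext₂
  have h1 : ContDiffOn ℝ ∞ ext₁ (Iio T ×ˢ univ) := Seeley.contDiffOn_extend hT isOpen_univ (hΦ.mono hslab)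
  have h2 : ContDiffOn ℝ ∞ ext₂ (Iio T ×ˢ univ) := Seeley.contDiffOn_extend hT isOpen_univ (hΦr.mono hslab)
  -- uniform bounds of order `≤ n`
  have hB1 : ∃ C, ∀ i ≤ n, ∀ p : ℝ × E, p.1 < T → ‖iteratedFDeriv ℝ i ext₁ p‖ ≤ C := by
    choose C hC using fun i => seeley_extend_bound hT hΦ hb i
    refine ⟨∑ i ∈ Finset.range (n + 1), |C i|, fun i hi p hp => ((hC i p hp).trans (le_abs_self _)).trans ?_⟩
    exact Finset.single_le_sum (f := fun i => |C i|) (fun _ _ => abs_nonneg _)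
      (Finset.mem_range.2 (Nat.lt_succ_of_le hi))
  have hB2 : ∃ C, ∀ i ≤ n, ∀ p : ℝ × E, p.1 < T → ‖iteratedFDeriv ℝ i ext₂ p‖ ≤ C := by
    choose C hC using fun i => seeley_extend_bound hT hΦr hbr i
    refine ⟨∑ i ∈ Finset.range (n + 1), |C i|, fun i hi p hp => ((hC i p hp).trans (le_abs_self _)).trans ?_⟩
    exact Finset.single_le_sum (f := fun i => |C i|) (fun _ _ => abs_nonneg _)
      (Finset.mem_range.2 (Nat.lt_succ_of_le hi))
  have hBw : ∃ C, ∀ i ≤ n, ∀ p : ℝ × E, ‖iteratedFDeriv ℝ i (fun p : ℝ × E => glueWeight (p.1 / T)) p‖ ≤ C := by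
    choose C hC using fun i => norm_iteratedFDeriv_glue_le (E := E) T i
    refine ⟨∑ i ∈ Finset.range (n + 1), |C i|, fun i hi p => ((hC i p).trans (le_abs_self _)).trans ?_⟩
    exact Finset.single_le_sum (f := fun i => |C i|) (fun _ _ => abs_nonneg _)
      (Finset.mem_range.2 (Nat.lt_succ_of_le hi))
  have hBw' : ∃ C, ∀ i ≤ n, ∀ p : ℝ × E,
      ‖iteratedFDeriv ℝ i (fun p : ℝ × E => 1 - glueWeight (p.1 / T)) p‖ ≤ C := by
    choose C hC using fun i => norm_iteratedFDeriv_one_sub_glue_le (E := E) T i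
    refine ⟨∑ i ∈ Finset.range (n + 1), |C i|, fun i hi p => ((hC i p).trans (le_abs_self _)).trans ?_⟩
    exact Finset.single_le_sum (f := fun i => |C i|) (fun _ _ => abs_nonneg _)
      (Finset.mem_range.2 (Nat.lt_succ_of_le hi))
  obtain ⟨C1, hC1⟩ := hB1
  obtain ⟨C2, hC2⟩ := hB2
  obtain ⟨Cw, hCw⟩ := hBw
  obtain ⟨Cw', hCw'⟩ := hBw'
  -- the weight and the two pieces
  have hw : ContDiff ℝ ∞ fun p : ℝ × E => glueWeight (p.1 / T) :=
    contDiff_glueWeight.comp (contDiff_fst.div_const T)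
  set P1 : ℝ × E → W := fun p => glueWeight (p.1 / T) • ext₁ p with hP1
  set P2 : ℝ × E → W := fun p => (1 - glueWeight (p.1 / T)) • ext₂ (T - p.1, p.2) with hP2
  -- piece 2 as a composition with the reflection
  set L : (ℝ × E) ≃L[ℝ] (ℝ × E) :=
    (ContinuousLinearEquiv.neg ℝ).prodCongr (ContinuousLinearEquiv.refl ℝ E) with hL
  set c : ℝ × E := (T, 0) with hc
  have hg2eq : (fun p : ℝ × E => ext₂ (T - p.1, p.2)) = fun q => ext₂ (c + L q) := by
    funext q; simp [hc, hL, sub_eq_add_neg]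
  set S₁ : Set (ℝ × E) := Iio 0 ×ˢ univ with hS₁
  have hS₁o : IsOpen S₁ := isOpen_Iio.prod isOpen_univ
  have hpre : L ⁻¹' S₁ = Ioi 0 ×ˢ univ := by
    ext q
    simp [hS₁, hL]
  have hvadd : c +ᵥ S₁ = Iio T ×ˢ univ := by
    ext q
    rw [Set.mem_vadd_set_iff_neg_vadd_mem]
    simp only [hS₁, hc, mem_prod, mem_Iio, mem_univ, and_true, Prod.neg_mk, neg_zero,
      vadd_eq_add, Prod.fst_add]
    constructor <;> intro h <;> linarith
  have hg2 : ContDiffOn ℝ ∞ (fun p : ℝ × E => ext₂ (T - p.1, p.2)) (Ioi 0 ×ˢ univ) := by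
    have hr : ContDiff ℝ ∞ fun p : ℝ × E => ((T - p.1, p.2) : ℝ × E) :=
      (contDiff_const.sub contDiff_fst).prodMk contDiff_snd
    refine h2.comp hr.contDiffOn fun p hp => ?_
    exact ⟨by simp only [mem_Iio]; linarith [mem_Ioi.1 hp.1], mem_univ _⟩
  set ML : ℝ := max 1 ‖(L : (ℝ × E) →L[ℝ] (ℝ × E))‖ with hML
  have hg2b : ∀ i ≤ n, ∀ p ∈ Ioi (0 : ℝ) ×ˢ (univ : Set E),
      ‖iteratedFDeriv ℝ i (fun p : ℝ × E => ext₂ (T - p.1, p.2)) p‖ ≤ C2 * ML ^ n := by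
    intro i hi p hp
    have hpL : L p ∈ S₁ := by rw [← mem_preimage, hpre]; exact hp
    have h := norm_iteratedFDerivWithin_comp_affine_le (f := ext₂) L c hS₁o.uniqueDiffOn hpL i
    rw [hpre, hvadd, iteratedFDerivWithin_of_isOpen i (isOpen_Ioi.prod isOpen_univ) hp] at h
    have hcp : c + L p ∈ Iio T ×ˢ (univ : Set E) := by rw [← hvadd]; exact Set.vadd_mem_vadd_set hpL
    rw [iteratedFDerivWithin_of_isOpen i (isOpen_Iio.prod isOpen_univ) hcp] at h
    rw [hg2eq]
    refine h.trans ?_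
    have hC20 : 0 ≤ C2 := (norm_nonneg _).trans (hC2 0 (Nat.zero_le _) _ hcp.1)
    have hpow : ‖(L : (ℝ × E) →L[ℝ] (ℝ × E))‖ ^ i ≤ ML ^ n :=
      (pow_le_pow_left₀ (norm_nonneg _) (le_max_right _ _) i).trans
        (pow_le_pow_right₀ (le_max_left _ _) hi)
    exact mul_le_mul (hC2 i hi _ hcp.1) hpow (by positivity) hC20
  -- ### bounds for the two pieces
  have hP1b : ∀ p : ℝ × E, ‖iteratedFDeriv ℝ n P1 p‖ ≤ 2 ^ n * Cw * C1 := by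
    intro p
    by_cases hp : p.1 < T
    · exact norm_iteratedFDeriv_smul_le_of_open (isOpen_Iio.prod isOpen_univ) hw h1 hCw
        (fun i hi q hq => hC1 i hi q hq.1) ⟨hp, mem_univ _⟩
    · have hV : IsOpen {q : ℝ × E | 2 * T / 3 < q.1} := isOpen_lt continuous_const continuous_fst
      have hzero : ∀ q ∈ {q : ℝ × E | 2 * T / 3 < q.1}, P1 q = 0 := by
        intro q hq
        have h0 : glueWeight (q.1 / T) = 0 := glueWeight_eq_zero (by rw [le_div_iff₀ hT]; linarith [hq.out])
        simp [hP1, h0]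
      rw [iteratedFDeriv_eq_zero_of_eqOn hV hzero (by simp only [mem_setOf_eq]; linarith [not_lt.1 hp]) n,
        norm_zero]
      have : 0 ≤ Cw := (norm_nonneg _).trans (hCw 0 (Nat.zero_le _) p)
      have : 0 ≤ C1 := (norm_nonneg _).trans (hC1 0 (Nat.zero_le _) ((0 : ℝ), p.2) hT)
      positivity
  have hP2b : ∀ p : ℝ × E, ‖iteratedFDeriv ℝ n P2 p‖ ≤ 2 ^ n * Cw' * (C2 * ML ^ n) := by
    intro p
    by_cases hp : 0 < p.1
    · exact norm_iteratedFDeriv_smul_le_of_open (isOpen_Ioi.prod isOpen_univ) (contDiff_const.sub hw)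
        hg2 hCw' hg2b ⟨hp, mem_univ _⟩
    · have hV : IsOpen {q : ℝ × E | q.1 < T / 3} := isOpen_lt continuous_fst continuous_const
      have hzero : ∀ q ∈ {q : ℝ × E | q.1 < T / 3}, P2 q = 0 := by
        intro q hq
        have h0 : glueWeight (q.1 / T) = 1 := glueWeight_eq_one (by rw [div_le_iff₀ hT]; linarith [hq.out])
        simp [hP2, h0]
      rw [iteratedFDeriv_eq_zero_of_eqOn hV hzero (by simp only [mem_setOf_eq]; linarith [not_lt.1 hp]) n,
        norm_zero]
      have : 0 ≤ Cw' := (norm_nonneg _).trans (hCw' 0 (Nat.zero_le _) p)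
      have : 0 ≤ C2 := (norm_nonneg _).trans (hC2 0 (Nat.zero_le _) ((0 : ℝ), p.2) hT)
      have : 0 ≤ ML := le_max_of_le_left zero_le_one
      positivity
  -- ### the sum
  have hP1s : ContDiff ℝ ∞ P1 := by
    refine contDiff_smul_of_open_cover (U := Iio T ×ˢ univ) (V := {p : ℝ × E | 2 * T / 3 < p.1})
      (isOpen_Iio.prod isOpen_univ) (isOpen_lt continuous_const continuous_fst) ?_ hw ?_ h1
    · ext p
      simp only [mem_union, mem_prod, mem_Iio, mem_univ, and_true, mem_setOf_eq, iff_true]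
      by_cases h : p.1 < T
      · exact Or.inl h
      · right; linarith [not_lt.1 h]
    · intro p hp
      exact glueWeight_eq_zero (by rw [le_div_iff₀ hT]; linarith [hp.out])
  have hP2s : ContDiff ℝ ∞ P2 := by
    refine contDiff_smul_of_open_cover (U := Ioi 0 ×ˢ univ) (V := {p : ℝ × E | p.1 < T / 3})
      (isOpen_Ioi.prod isOpen_univ) (isOpen_lt continuous_fst continuous_const) ?_
      (contDiff_const.sub hw) ?_ hg2
    · ext p
      simp only [mem_union, mem_prod, mem_Ioi, mem_univ, and_true, mem_setOf_eq, iff_true]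
      by_cases h : 0 < p.1
      · exact Or.inl h
      · right; linarith [not_lt.1 h]
    · intro p hp
      have h1' : glueWeight (p.1 / T) = 1 := glueWeight_eq_one (by rw [div_le_iff₀ hT]; linarith [hp.out])
      rw [h1', sub_self]
  have heq : uncurry (slabExtend T Φ) = P1 + P2 := by funext p; rfl
  refine ⟨2 ^ n * Cw * C1 + 2 ^ n * Cw' * (C2 * ML ^ n), fun p => ?_⟩
  rw [heq, iteratedFDeriv_add_apply (hP1s.contDiffAt.of_le (mod_cast le_top))
    (hP2s.contDiffAt.of_le (mod_cast le_top))]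
  exact (norm_add_le _ _).trans (add_le_add (hP1b p) (hP2b p))

set_option maxHeartbeats 800000 in
/-- **`C_b^∞` extension from a closed slab.** A field `v : ℝ → E → W` jointly `C^∞` on
`[a, b] × E` (within, `a < b`) with all within-slab derivatives bounded agrees on `[a, b]` with a
field `ṽ` which is `C^∞` on `ℝ × E` with every derivative bounded (the slab extension of the
time-translate `s ↦ v (a + s)`, translated back). -/
theorem exists_cb_extension [CompleteSpace W] {v : ℝ → E → W} {a b : ℝ} (hab : a < b)
    (hv : ContDiffOn ℝ ∞ (uncurry v) (Icc a b ×ˢ univ))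
    (hvb : ∀ n, ∃ C, ∀ p ∈ Icc a b ×ˢ (univ : Set E),
      ‖iteratedFDerivWithin ℝ n (uncurry v) (Icc a b ×ˢ univ) p‖ ≤ C) :
    ∃ w : ℝ → E → W, ContDiff ℝ ∞ (uncurry w) ∧
      (∀ n, ∃ C, ∀ p, ‖iteratedFDeriv ℝ n (uncurry w) p‖ ≤ C) ∧ ∀ t ∈ Icc a b, w t = v t := by
  have hT0 : 0 < b - a := sub_pos.2 hab
  have hset : (((a, (0 : E)) : ℝ × E) +ᵥ (Icc 0 (b - a) ×ˢ (univ : Set E))) = Icc a b ×ˢ univ := by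
    ext q
    rw [Set.mem_vadd_set_iff_neg_vadd_mem]
    simp only [mem_prod, mem_Icc, mem_univ, and_true, Prod.neg_mk, neg_zero,
      vadd_eq_add, Prod.fst_add]
    constructor <;> intro h <;> constructor <;> linarith [h.1, h.2]
  have hfun : (uncurry fun s y => v (a + s) y) =
      fun q : ℝ × E => uncurry v (((a, (0 : E)) : ℝ × E) + q) := by
    funext q; simp [uncurry]
  -- the translate is slab-smooth with bounded within-slab derivatives
  have hΦs : ContDiffOn ℝ ∞ (uncurry fun s y => v (a + s) y) (Icc 0 (b - a) ×ˢ univ) := by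
    rw [hfun]
    refine hv.comp (contDiff_const.add contDiff_id).contDiffOn fun q hq => ?_
    rw [← hset]
    exact Set.vadd_mem_vadd_set hq
  have hΦb : ∀ j, ∃ C, ∀ p ∈ Icc 0 (b - a) ×ˢ (univ : Set E),
      ‖iteratedFDerivWithin ℝ j (uncurry fun s y => v (a + s) y) (Icc 0 (b - a) ×ˢ univ) p‖ ≤ C := by
    intro j
    obtain ⟨C, hC⟩ := hvb j
    refine ⟨C, fun p hp => ?_⟩
    rw [hfun, iteratedFDerivWithin_comp_add_left, hset]
    refine hC _ ?_
    rw [← hset]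
    exact Set.vadd_mem_vadd_set hp
  -- the extension, translated back
  have hΨs := contDiff_uncurry_slabExtend hT0 hΦs
  have hΨb := slabExtend_bound hT0 hΦs hΦb
  refine ⟨fun t x => slabExtend (b - a) (fun s y => v (a + s) y) (t - a) x, ?_, ?_, ?_⟩
  · exact hΨs.comp ((contDiff_fst.sub contDiff_const).prodMk contDiff_snd)
  · intro n
    obtain ⟨C, hC⟩ := hΨb n
    refine ⟨C, fun p => ?_⟩
    have hfun2 : (uncurry fun t x => slabExtend (b - a) (fun s y => v (a + s) y) (t - a) x) =
        fun q : ℝ × E => uncurry (slabExtend (b - a) (fun s y => v (a + s) y)) (q - (a, 0)) := by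
      funext q; simp [uncurry]
    rw [hfun2, iteratedFDeriv_comp_sub]
    exact hC _
  · intro t ht
    funext x
    show slabExtend (b - a) (fun s y => v (a + s) y) (t - a) x = v t x
    rw [slabExtend_apply_of_mem ⟨by linarith [ht.1], by linarith [ht.2]⟩]
    simp

/-- Anchor (registered sub-stub of stub W2): `exists_cb_extension` for fields on `ℝ³` with
values in `ℝ³` (closed form). -/
theorem w2aux_cbExtension : ∀ (v : ℝ → EuclideanSpace ℝ (Fin 3) → EuclideanSpace ℝ (Fin 3))
    (a b : ℝ), a < b → ContDiffOn ℝ ∞ (uncurry v) (Icc a b ×ˢ univ) →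
    (∀ n, ∃ C, ∀ p ∈ Icc a b ×ˢ (univ : Set (EuclideanSpace ℝ (Fin 3))),
      ‖iteratedFDerivWithin ℝ n (uncurry v) (Icc a b ×ˢ univ) p‖ ≤ C) →
    ∃ w : ℝ → EuclideanSpace ℝ (Fin 3) → EuclideanSpace ℝ (Fin 3), ContDiff ℝ ∞ (uncurry w) ∧
      (∀ n, ∃ C, ∀ p, ‖iteratedFDeriv ℝ n (uncurry w) p‖ ≤ C) ∧ ∀ t ∈ Icc a b, w t = v t :=
  fun _ _ _ hab hv hvb => exists_cb_extension hab hv hvb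

end Summit.NavierStokesRegularity.NavierStokesRegularity.Theorems.SelfMixingDichotomy.MixingPayoffBirth

end
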